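import Mathlib.CategoryTheory.Pi.Basic
import Mathlib.CategoryTheory.Limits.Shapes.BinaryProducts
import Mathlib.CategoryTheory.Limits.Shapes.Products
import Mathlib.CategoryTheory.Limits.Shapes.Terminal
import Mathlib.CategoryTheory.Limits.Shapes.Countable
import Literature.AlgebraicGeometry.Frobenioids.Categories
import HarnessLib

/-!
# Semi-graphs of anabelioids, §3, Remark 3.1.5 — product layer: initial and connected objects,
# epimorphisms and coproducts in a product of categories `∏ᵢ Cᵢ`

Mochizuki, *Semi-graphs of anabelioids*, Publ. RIMS **42** (2006), §3, Remark 3.1.5 (manuscript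
p. 34) [cite: MochizukiSemiAnbd2006, Rmk 3.1.5 p.34]: "every temperoid is an almost totally epimorphic
category of countably connected type".  A temperoid is equivalent to a countable PRODUCT of categories
`B^temp(Πᵢ)` (Definition 3.1 (ii) as typed in `Temperoids.lean`, abc-iut-L3-t2; Mathlib's
`CategoryTheory.pi`).  This proof-only file supplies the product-category layer of the discharge of
the named fact `TemperoidAlmostTotallyEpimorphic`, for an arbitrary family of categories with initial
objects: an object of `∏ᵢ Cᵢ` is initial iff it is so coordinatewise; binary cofans and cofans that are
colimits coordinatewise are colimits; a connected object ([FrdI] §0) has exactly one non-initial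
coordinate, which is connected; hence ("strict" initial objects in the factors — a morphism out of a
non-initial object has non-initial target — as in `B^temp(Π)`, where initial = empty) `∏ᵢ Cᵢ` is
almost totally epimorphic when the factors are, and has countable coproducts when the factors do.  The
universe of the index type is arbitrary (Mathlib's `CategoryTheory.Limits.Pi` requires it to be the
morphism universe, which the temperoid charts — `ι : Type` — do not satisfy; hence the direct
constructions here).  Nothing is specific to temperoids; nothing takes a side on [IUTchIII] Cor. 3.12.
-/

namespace Literature.AnabelianGeometry.SemiGraphs

namespace TemperoidProduct

open CategoryTheory CategoryTheory.Limits
open Literature.AlgebraicGeometry.Frobenioids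

universe w w' v₁ u₁

/-! ### Splittings of an object as a binary coproduct ("pieces") -/

section Piece

variable {E : Type u₁} [Category.{v₁} E]

/-- An object that fails to be non-initial is initial. [cite: MochizukiFrdI2008, §0 p.15] -/
theorem nonempty_isInitial_of_not_isNonemptyObj {A : E} (h : ¬ IsNonemptyObj A) :
    Nonempty (IsInitial A) := by
  unfold IsNonemptyObj at h
  rwa [not_isEmpty_iff] at h

/-- A splitting of `B` as a binary coproduct `B ≅ X₁ ⊔ X₂` (a colimit binary cofan with vertex `B`).
[cite: MochizukiFrdI2008, §0 p.15] -/
structure Piece (B : E) where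
  /-- first summand -/
  X₁ : E
  /-- second summand -/
  X₂ : E
  /-- first injection -/
  ι₁ : X₁ ⟶ B
  /-- second injection -/
  ι₂ : X₂ ⟶ B
  /-- the cofan is a colimit -/
  colim : IsColimit (BinaryCofan.mk ι₁ ι₂)

/-- The trivial splitting `B ≅ B ⊔ ⊥`. [cite: MochizukiFrdI2008, §0 p.15] -/
noncomputable def Piece.left [HasInitial E] (B : E) : Piece B where
  X₁ := B
  X₂ := ⊥_ E
  ι₁ := 𝟙 B
  ι₂ := initial.to B
  colim := BinaryCofan.isColimitMk (fun s => s.inl) (fun _ => Category.id_comp _)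
    (fun _ => initialIsInitial.hom_ext _ _) (fun s m h₁ _ => by simpa using h₁)

/-- The trivial splitting `B ≅ ⊥ ⊔ B`. [cite: MochizukiFrdI2008, §0 p.15] -/
noncomputable def Piece.right [HasInitial E] (B : E) : Piece B where
  X₁ := ⊥_ E
  X₂ := B
  ι₁ := initial.to B
  ι₂ := 𝟙 B
  colim := BinaryCofan.isColimitMk (fun s => s.inr) (fun _ => initialIsInitial.hom_ext _ _)
    (fun _ => Category.id_comp _) (fun s m _ h₂ => by simpa using h₂)

/-- An initial object splits as `B ≅ B ⊔ B`. [cite: MochizukiFrdI2008, §0 p.15] -/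
def Piece.ofIsInitial (B : E) (hB : IsInitial B) : Piece B where
  X₁ := B
  X₂ := B
  ι₁ := 𝟙 B
  ι₂ := 𝟙 B
  colim := BinaryCofan.isColimitMk (fun s => s.inl) (fun _ => Category.id_comp _)
    (fun _ => hB.hom_ext _ _) (fun s m h₁ _ => by simpa using h₁)

end Piece

/-! ### Initial objects and colimits in `∏ᵢ Cᵢ` -/

variable {I : Type w} {C : I → Type u₁} [∀ i, Category.{v₁} (C i)]

/-- An object of `∏ᵢ Cᵢ` that is initial coordinatewise is initial. [folklore] -/
def isInitialPi (A : ∀ i, C i) (h : ∀ i, IsInitial (A i)) : IsInitial A :=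
  IsInitial.ofUniqueHom (fun Y i => (h i).to (Y i)) fun _ _ => by
    ext i
    exact (h i).hom_ext _ _

/-- A non-initial object of `∏ᵢ Cᵢ` has a non-initial coordinate (step of the verification of
[SemiAnbd] Rmk. 3.1.5 for products of temperoid charts). [cite: MochizukiSemiAnbd2006, Rmk 3.1.5 p.34] -/
theorem exists_isNonemptyObj_apply {A : ∀ i, C i} (hA : IsNonemptyObj A) :
    ∃ i, IsNonemptyObj (A i) := by
  by_contra h
  push Not at h
  exact hA.false (isInitialPi A fun i => (nonempty_isInitial_of_not_isNonemptyObj (h i)).some)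

/-- A binary cofan of `∏ᵢ Cᵢ` that is a colimit coordinatewise is a colimit. [folklore] -/
def isColimitBinaryCofanPi {A B₁ B₂ : ∀ i, C i} (ι₁ : B₁ ⟶ A) (ι₂ : B₂ ⟶ A)
    (h : ∀ i, IsColimit (BinaryCofan.mk (ι₁ i) (ι₂ i))) : IsColimit (BinaryCofan.mk ι₁ ι₂) :=
  BinaryCofan.isColimitMk (fun s i => (h i).desc (BinaryCofan.mk (s.inl i) (s.inr i)))
    (fun s => by
      ext i
      exact (h i).fac (BinaryCofan.mk (s.inl i) (s.inr i)) ⟨WalkingPair.left⟩)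
    (fun s => by
      ext i
      exact (h i).fac (BinaryCofan.mk (s.inl i) (s.inr i)) ⟨WalkingPair.right⟩)
    (fun s m h₁ h₂ => by
      ext i
      exact (h i).uniq (BinaryCofan.mk (s.inl i) (s.inr i)) (m i) fun j => by
        rcases j with ⟨_ | _⟩
        · exact congrFun h₁ i
        · exact congrFun h₂ i)

/-- The cofan of `∏ᵢ Cᵢ` assembled from coordinatewise cofans. [folklore] -/
def cofanPi {K : Type w'} (X : K → ∀ i, C i) (c : ∀ i, Cofan fun k => X k i) : Cofan X :=
  Cofan.mk (fun i => (c i).pt) fun k i => (c i).inj k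

/-- Coordinatewise colimit cofans assemble to a colimit cofan of `∏ᵢ Cᵢ`. [folklore] -/
def isColimitCofanPi {K : Type w'} (X : K → ∀ i, C i) (c : ∀ i, Cofan fun k => X k i)
    (hc : ∀ i, IsColimit (c i)) : IsColimit (cofanPi X c) :=
  Cofan.IsColimit.mk _ (fun s i => (hc i).desc (Cofan.mk (s.pt i) fun k => s.inj k i))
    (fun s k => by
      ext i
      exact (hc i).fac (Cofan.mk (s.pt i) fun k => s.inj k i) ⟨k⟩)
    (fun s m hm => by
      ext i
      exact (hc i).uniq (Cofan.mk (s.pt i) fun k => s.inj k i) (m i)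
        fun ⟨k⟩ => congrFun (hm k) i)

/-- `∏ᵢ Cᵢ` has coproducts of shape `K` when every factor does (step of the verification of
[SemiAnbd] Rmk. 3.1.5: countable coproducts in a temperoid). [cite: MochizukiSemiAnbd2006, Rmk 3.1.5 p.34] -/
theorem hasCoproductsOfShape_pi (K : Type w') [∀ i, HasCoproductsOfShape K (C i)] :
    HasCoproductsOfShape K (∀ i, C i) :=
  ⟨fun F => by
    haveI : HasColimit (Discrete.functor (F.obj ∘ Discrete.mk)) :=
      ⟨⟨⟨cofanPi (F.obj ∘ Discrete.mk) fun i =>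
          colimit.cocone (Discrete.functor fun k => (F.obj ∘ Discrete.mk) k i),
        isColimitCofanPi _ _ fun i => colimit.isColimit _⟩⟩⟩
    exact hasColimit_of_iso (Discrete.natIsoFunctor (F := F))⟩

/-- `∏ᵢ Cᵢ` has countable coproducts when every factor does. [cite: MochizukiFrdI2008, §0 p.15] -/
theorem hasCountableCoproducts_pi (h : ∀ i, HasCountableCoproducts (C i)) :
    HasCountableCoproducts (∀ i, C i) :=
  ⟨fun J _ => by
    haveI : ∀ i, HasCoproductsOfShape J (C i) := fun i => (h i).out J
    exact hasCoproductsOfShape_pi J⟩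

/-! ### Connected objects of `∏ᵢ Cᵢ` (factors with initial objects) -/

variable [∀ i, HasInitial (C i)]

/-- The coordinatewise-initial object of `∏ᵢ Cᵢ` is initial. [folklore] -/
noncomputable def botPiIsInitial : IsInitial (fun i => ⊥_ (C i) : ∀ i, C i) :=
  isInitialPi _ fun _ => initialIsInitial

/-- Coordinates of an initial object of `∏ᵢ Cᵢ` are initial. [folklore] -/
noncomputable def isInitialApply {A : ∀ i, C i} (hA : IsInitial A) (i : I) : IsInitial (A i) :=
  initialIsInitial.ofIso (Pi.isoApp (hA.uniqueUpToIso botPiIsInitial) i).symm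

/-- An object of `∏ᵢ Cᵢ` with a non-initial coordinate is non-initial (step of the verification of
[SemiAnbd] Rmk. 3.1.5). [cite: MochizukiSemiAnbd2006, Rmk 3.1.5 p.34] -/
theorem isNonemptyObj_of_apply {A : ∀ i, C i} (i : I) (h : IsNonemptyObj (A i)) :
    IsNonemptyObj A :=
  ⟨fun hA => h.false (isInitialApply hA i)⟩

/-- A connected object of `∏ᵢ Cᵢ` has exactly one non-initial coordinate (two non-initial
coordinates would split it as `B ≅ B' ⊔ B''`). [cite: MochizukiSemiAnbd2006, Rmk 3.1.5 p.34] -/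
theorem existsUnique_isNonemptyObj_apply {B : ∀ i, C i} (hB : IsConnectedObj B) :
    ∃ i₀, IsNonemptyObj (B i₀) ∧ ∀ j, j ≠ i₀ → ¬ IsNonemptyObj (B j) := by
  classical
  obtain ⟨i₀, hi₀⟩ := exists_isNonemptyObj_apply hB.1
  refine ⟨i₀, hi₀, fun j hj hBj => ?_⟩
  let p : ∀ i, Piece (B i) := fun i => if i = j then Piece.right (B i) else Piece.left (B i)
  have hcol : IsColimit (BinaryCofan.mk (fun i => (p i).ι₁ : (fun i => (p i).X₁) ⟶ B)
      (fun i => (p i).ι₂ : (fun i => (p i).X₂) ⟶ B)) :=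
    isColimitBinaryCofanPi _ _ fun i => (p i).colim
  refine (hB.2 (fun i => (p i).X₁) (fun i => (p i).X₂) _ _ ?_ ?_).false hcol
  · have hp : p i₀ = Piece.left (B i₀) := if_neg (Ne.symm hj)
    refine isNonemptyObj_of_apply i₀ ?_
    rw [hp]
    exact hi₀
  · have hp : p j = Piece.right (B j) := if_pos rfl
    refine isNonemptyObj_of_apply j ?_
    rw [hp]
    exact hBj

/-- **Connected objects of a product**: a connected object of `∏ᵢ Cᵢ` has exactly one non-initial
coordinate, and that coordinate is connected (a splitting of it would split the object, the other —
initial — coordinates splitting trivially). [cite: MochizukiSemiAnbd2006, Rmk 3.1.5 p.34] -/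
theorem isConnectedObj_apply {B : ∀ i, C i} (hB : IsConnectedObj B) :
    ∃ i₀, IsConnectedObj (B i₀) ∧ ∀ j, j ≠ i₀ → ¬ IsNonemptyObj (B j) := by
  classical
  obtain ⟨i₀, hi₀, hrest⟩ := existsUnique_isNonemptyObj_apply hB
  refine ⟨i₀, ⟨hi₀, fun B₁ B₂ ι₁ ι₂ hB₁ hB₂ => ⟨fun hc => ?_⟩⟩, hrest⟩
  let given : Piece (B i₀) := ⟨B₁, B₂, ι₁, ι₂, hc⟩
  let p : ∀ i, Piece (B i) := fun i =>
    if h : i = i₀ then h ▸ given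
    else Piece.ofIsInitial (B i) (nonempty_isInitial_of_not_isNonemptyObj (hrest i h)).some
  have hcol : IsColimit (BinaryCofan.mk (fun i => (p i).ι₁ : (fun i => (p i).X₁) ⟶ B)
      (fun i => (p i).ι₂ : (fun i => (p i).X₂) ⟶ B)) :=
    isColimitBinaryCofanPi _ _ fun i => (p i).colim
  have hp : p i₀ = given := by
    simp only [p, dif_pos]
  refine (hB.2 (fun i => (p i).X₁) (fun i => (p i).X₂) _ _ ?_ ?_).false hcol
  · refine isNonemptyObj_of_apply i₀ ?_
    rw [hp]
    exact hB₁
  · refine isNonemptyObj_of_apply i₀ ?_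
    rw [hp]
    exact hB₂

/-- **A product of almost totally epimorphic categories with strict initial objects is almost totally
epimorphic.** [cite: MochizukiSemiAnbd2006, Rmk 3.1.5 p.34] -/
theorem isAlmostTotallyEpimorphic_pi
    (hstrict : ∀ i {A B : C i} (_ : A ⟶ B), IsNonemptyObj A → IsNonemptyObj B)
    (hC : ∀ i, IsAlmostTotallyEpimorphic (C i)) : IsAlmostTotallyEpimorphic (∀ i, C i) := by
  classical
  refine ⟨fun {A B} f hA hB => ⟨fun g h w => ?_⟩⟩
  obtain ⟨i₀, hBi₀, hrest⟩ := isConnectedObj_apply hB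
  ext i
  by_cases hi : i = i₀
  · subst hi
    have hAi : IsNonemptyObj (A i) := by
      obtain ⟨j, hj⟩ := exists_isNonemptyObj_apply hA
      by_cases hji : j = i
      · exact hji ▸ hj
      · exact absurd (hstrict j (f j) hj) (hrest j hji)
    haveI := (hC i).epi (f i) hAi hBi₀
    exact (cancel_epi (f i)).mp (congrFun w i)
  · exact (nonempty_isInitial_of_not_isNonemptyObj (hrest i hi)).some.hom_ext _ _

end TemperoidProduct

end Literature.AnabelianGeometry.SemiGraphs
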